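import Literature.NumberTheory.Automorphic.GodementJacquetAtoms
import Mathlib.LinearAlgebra.Matrix.Transvection
import HarnessLib

/-!
# Refining congruence classes of matrices: Gaussian elimination modulo `ϖ` on the unpinned
block, and the dichotomy for the classes of pinned matrices at the next precision

Topic `NumberTheory/Automorphic`. Third support file of the discharge of
`GodementJacquet1972_local_existsUnique_hasGJLFactor` (`GodementJacquetLocal`; Godement–Jacquet,
LNM 260 (1972), Thm. 3.3 (2)), after `GodementJacquetZetaHeckeShift` and `GodementJacquetAtoms`
(`gjClass`, `gjPin`). Setting: a field `F` with a `ValuativeRel`, a uniformizing element `ϖ`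
(`IsUniformizingElement`), `K_m = congruenceGL n |ϖ|^m`, residue field `𝓀 = 𝓀[F]`. All results
proved; the definitions are bookkeeping devices.

* `resF` (**definition**): the residue in `𝓀` of an element of `F` (junk `0` off `𝒪`), additive and
  multiplicative on `𝒪`, with `Matrix.map resF` multiplicative on integral matrices
  (`map_resF_mul`, `map_resF_list_prod`, `map_resF_transvection`).
* `liftTS` / `embTS` (**definitions**): lift of a transvection over `𝓀` to an integral transvection over
  `F`, and embedding of a transvection of the index subtype `{i // i ∉ S}` into `Fin n`;
  `IsBlockOneOn S P` (**definition**: `P` is the identity on the rows and columns in `S`; such `P`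
  fix the pinned matrices, `IsBlockOneOn.mul_gjPin`), `IsBlockSuppOn S M` (**definition**: `M` is
  supported on `Sᶜ × Sᶜ`), `blockOf S M` (**definition**: the block `Sᶜ × Sᶜ`), and the block action
  of (products of) embedded transvections (`embTS_toMatrix_mul`, `prod_embTS_mul`, …);
  `unitOfTransvections` (**definition**: the unit of `GL_n` given by a list of transvections).
* `exists_blockElim` (**Gaussian elimination modulo `ϖ` on a block**): for an integral matrix `W`
  supported on `Sᶜ × Sᶜ` there are `P, Q, Δ ∈ GL_n(𝒪)`, the identity on the rows and columns in
  `S` (with `P⁻¹`, `Q⁻¹`), `Δ` diagonal with unit entries, and `T ⊆ Sᶜ`, with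
  `P W Q ≡ Δ · diag(𝟙_T) (mod ϖ)` entrywise, and `T = ∅` only if `W ≡ 0 (mod ϖ)`: Mathlib's
  reduction of `W̄|_{Sᶜ × Sᶜ}` to diagonal form by transvections over the residue field
  (`Matrix.Pivot.exists_list_transvec_mul_mul_list_transvec_eq_diagonal`), lifted to integral
  transvections of `GL_n(F)` with indices in `Sᶜ`.
* `exists_corrections_gjPin_add`: for `D = gjPin ϖ S a` with `a_i + c ≤ N` on `S` (`c ≥ 1`) and `Z'`
  integral, explicit `L, R ∈ K_c` with `D + ϖ^N Z' - L D R ≡ ϖ^N W (mod ϖ^{N+1})`, `W` the block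
  `Sᶜ × Sᶜ` of `Z'`.
* **The dichotomy** (`exists_mem_gjClass_succ_of_block_small`, `mem_gjClass_succ_of_block_small`,
  `exists_mem_gjClass_succ_morePins`, `mem_gjClass_succ_dichotomy`): `D + ϖ^N Z'` lies either in
  `gjClass ϖ m (N+1) (L D R)` (block of `Z'` divisible by `ϖ`; so in `gjClass ϖ m (N+1) D` when
  `c = m`) or in `gjClass ϖ m (N+1) (κ D' κ')` with `κ, κ' ∈ GL_n(𝒪)` and
  `D' = gjPin ϖ (S ∪ T) a'` having a non-empty set `T ⊆ Sᶜ` of new pins of exponent `N`; the same for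
  an arbitrary member of `gjClass ϖ m N D` (`mem_gjClass_succ_or_morePins` under the gap condition
  `a_i + m ≤ N`, `exists_mem_gjClass_succ_twist` under `a_i < N`).
* `exists_mem_gjClass_twist_gjPin` (**Smith normal form modulo `ϖ^N`**): every integral matrix lies
  in `gjClass ϖ m N (κ (gjPin ϖ S a) κ')` for some `κ, κ' ∈ GL_n(𝒪)`, `S`, and `a < N` on `S`
  (induction on `N`).

## References

* R. Godement, H. Jacquet, *Zeta functions of simple algebras*, LNM 260 (1972), §3
  [GodementJacquet1972].
-/

set_option autoImplicit false

noncomputable section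

open scoped MatrixGroups
open Matrix ValuativeRel

namespace Literature.NumberTheory.Automorphic

variable {F : Type*} [Field F] [ValuativeRel F] {n : ℕ} {ϖ : F}

/-! ### Residues of elements of `F` and of integral matrices -/

section Residue

/-- The residue in `𝓀[F]` of an element of `F`: `residue x` for `x ∈ 𝒪[F]`, junk value `0`
otherwise. [folklore] -/
def resF (x : F) : 𝓀[F] :=
  by classical exact if h : x ∈ 𝒪[F] then IsLocalRing.residue 𝒪[F] ⟨x, h⟩ else 0

/-- `resF` on `𝒪`. [folklore] -/
theorem resF_of_mem {x : F} (h : x ∈ 𝒪[F]) : resF x = IsLocalRing.residue 𝒪[F] ⟨x, h⟩ := by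
  classical
  exact dif_pos h

/-- `resF` of a coerced element of `𝒪`. [folklore] -/
theorem resF_coe (y : 𝒪[F]) : resF (y : F) = IsLocalRing.residue 𝒪[F] y := by
  rw [resF_of_mem y.2]

/-- `resF` of a chosen lift. [folklore] -/
@[simp] theorem resF_liftRes (c : 𝓀[F]) : resF ((liftRes c : 𝒪[F]) : F) = c := by
  rw [resF_coe, residue_liftRes]

/-- `resF 0 = 0`. [folklore] -/
@[simp] theorem resF_zero : resF (0 : F) = 0 := by
  rw [resF_of_mem (Subring.zero_mem _)]; exact map_zero _

/-- `resF 1 = 1`. [folklore] -/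
@[simp] theorem resF_one : resF (1 : F) = 1 := by
  rw [resF_of_mem (Subring.one_mem _)]; exact map_one _

/-- `resF` is additive on `𝒪`. [folklore] -/
theorem resF_add {x y : F} (hx : x ∈ 𝒪[F]) (hy : y ∈ 𝒪[F]) : resF (x + y) = resF x + resF y := by
  rw [resF_of_mem hx, resF_of_mem hy, resF_of_mem (Subring.add_mem _ hx hy), ← map_add]; rfl

/-- `resF` is multiplicative on `𝒪`. [folklore] -/
theorem resF_mul {x y : F} (hx : x ∈ 𝒪[F]) (hy : y ∈ 𝒪[F]) : resF (x * y) = resF x * resF y := by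
  rw [resF_of_mem hx, resF_of_mem hy, resF_of_mem (Subring.mul_mem _ hx hy), ← map_mul]; rfl

/-- `resF` commutes with negation on `𝒪`. [folklore] -/
theorem resF_neg {x : F} (hx : x ∈ 𝒪[F]) : resF (-x) = -resF x := by
  rw [resF_of_mem hx, resF_of_mem (Subring.neg_mem _ hx), ← map_neg]; rfl

/-- `resF` of a finite sum of elements of `𝒪`. [folklore] -/
theorem resF_sum {ι : Type*} (s : Finset ι) (f : ι → F) (h : ∀ i ∈ s, f i ∈ 𝒪[F]) :
    resF (∑ i ∈ s, f i) = ∑ i ∈ s, resF (f i) := by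
  classical
  induction s using Finset.induction_on with
  | empty => simp
  | @insert j s hj ih =>
    rw [Finset.sum_insert hj, Finset.sum_insert hj,
      resF_add (h j (Finset.mem_insert_self j s))
        (Subring.sum_mem _ fun i hi => h i (Finset.mem_insert_of_mem hi)),
      ih fun i hi => h i (Finset.mem_insert_of_mem hi)]

/-- `resF x = 0 ↔ |x| < 1` for `x ∈ 𝒪`. [folklore] -/
theorem resF_eq_zero_iff {x : F} (hx : x ∈ 𝒪[F]) : resF x = 0 ↔ valuation F x < 1 := by
  rw [resF_of_mem hx]
  exact ⟨fun h => valuation_lt_one_of_residue_eq_zero h, fun h => residue_eq_zero_of_valuation_lt_one h⟩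

/-- Elements of `𝒪` with the same residue differ by an element of valuation `< 1`. [folklore] -/
theorem valuation_sub_lt_one_of_resF_eq {x y : F} (hx : x ∈ 𝒪[F]) (hy : y ∈ 𝒪[F])
    (h : resF x = resF y) : valuation F (x - y) < 1 := by
  rw [← resF_eq_zero_iff (Subring.sub_mem _ hx hy), sub_eq_add_neg, resF_add hx (Subring.neg_mem _ hy),
    resF_neg hy, h, add_neg_cancel]

/-- **`Matrix.map resF` is multiplicative on integral matrices.** [folklore] -/
theorem map_resF_mul {ι : Type*} [Fintype ι] [DecidableEq ι] {A B : Matrix ι ι F}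
    (hA : ∀ i j, A i j ∈ 𝒪[F]) (hB : ∀ i j, B i j ∈ 𝒪[F]) :
    (A * B).map resF = A.map resF * B.map resF := by
  ext i j
  rw [Matrix.map_apply, Matrix.mul_apply, Matrix.mul_apply,
    resF_sum _ _ fun l _ => Subring.mul_mem _ (hA i l) (hB l j)]
  refine Finset.sum_congr rfl fun l _ => ?_
  rw [resF_mul (hA i l) (hB l j), Matrix.map_apply, Matrix.map_apply]

/-- A product of a list of integral matrices has integral entries. [folklore] -/
theorem list_prod_apply_mem_integer {ι : Type*} [Fintype ι] [DecidableEq ι] (l : List (Matrix ι ι F))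
    (hl : ∀ M ∈ l, ∀ i j, M i j ∈ 𝒪[F]) : ∀ i j, l.prod i j ∈ 𝒪[F] := by
  induction l with
  | nil => intro i j; rw [List.prod_nil, Matrix.one_apply]; split_ifs <;> simp
  | cons M l ih =>
    intro i j
    rw [List.prod_cons, Matrix.mul_apply]
    exact Subring.sum_mem _ fun k _ => Subring.mul_mem _ (hl M List.mem_cons_self i k)
      (ih (fun M' hM' => hl M' (List.mem_cons_of_mem M hM')) k j)

/-- `Matrix.map resF` of a product of a list of integral matrices. [folklore] -/
theorem map_resF_list_prod {ι : Type*} [Fintype ι] [DecidableEq ι] (l : List (Matrix ι ι F))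
    (hl : ∀ M ∈ l, ∀ i j, M i j ∈ 𝒪[F]) :
    l.prod.map resF = (l.map fun M => M.map resF).prod := by
  induction l with
  | nil =>
    ext i j
    simp only [List.prod_nil, List.map_nil, Matrix.map_apply, Matrix.one_apply]
    split_ifs <;> simp
  | cons M l ih =>
    have hM := hl M List.mem_cons_self
    have hl' : ∀ M' ∈ l, ∀ i j, M' i j ∈ 𝒪[F] := fun M' hM' => hl M' (List.mem_cons_of_mem M hM')
    rw [List.prod_cons, List.map_cons, List.prod_cons,
      map_resF_mul hM (list_prod_apply_mem_integer l hl'), ih hl']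

/-- `resF` of a transvection with integral coefficient. [folklore] -/
theorem map_resF_transvection {ι : Type*} [DecidableEq ι] (i j : ι) (c : 𝒪[F]) :
    (Matrix.transvection i j (c : F)).map resF = Matrix.transvection i j (IsLocalRing.residue 𝒪[F] c) := by
  ext a b
  rw [Matrix.map_apply, Matrix.transvection, Matrix.transvection, Matrix.add_apply, Matrix.add_apply,
    resF_add _ _]
  · congr 1
    · rw [Matrix.one_apply, Matrix.one_apply]; split_ifs <;> simp
    · by_cases h : i = a ∧ j = b
      · obtain ⟨rfl, rfl⟩ := h
        rw [Matrix.single_apply_same, Matrix.single_apply_same, resF_coe]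
      · rw [Matrix.single_apply_of_ne _ _ _ _ _ h, Matrix.single_apply_of_ne _ _ _ _ _ h, resF_zero]
  · rw [Matrix.one_apply]; split_ifs <;> simp
  · by_cases h : i = a ∧ j = b
    · obtain ⟨rfl, rfl⟩ := h
      rw [Matrix.single_apply_same]; exact c.2
    · rw [Matrix.single_apply_of_ne _ _ _ _ _ h]; exact Subring.zero_mem _

end Residue

/-! ### Transvections: lifts from the residue field and block action -/

section Transvections

open Matrix.TransvectionStruct

/-- Lift of a transvection over `𝓀` to a transvection over `F` with coefficient in `𝒪` (same
indices, coefficient `liftRes`). [folklore] -/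
def liftTS {ι : Type*} (t : Matrix.TransvectionStruct ι 𝓀[F]) : Matrix.TransvectionStruct ι F :=
  ⟨t.i, t.j, t.hij, ((liftRes t.c : 𝒪[F]) : F)⟩

/-- A transvection with integral coefficient is an integral matrix (any index type; compare
`transvection_apply_mem_integer` of `ReductiveGroupDataProofs` for `Fin n`). [folklore] -/
theorem transvection_apply_mem_integer_of_mem {ι : Type*} [DecidableEq ι] (i j : ι) {c : F} (hc : c ∈ 𝒪[F])
    (a b : ι) : Matrix.transvection i j c a b ∈ 𝒪[F] := by
  rw [Matrix.transvection, Matrix.add_apply]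
  refine Subring.add_mem _ ?_ ?_
  · rw [Matrix.one_apply]; split_ifs <;> simp
  · by_cases h : i = a ∧ j = b
    · obtain ⟨rfl, rfl⟩ := h
      rw [Matrix.single_apply_same]; exact hc
    · rw [Matrix.single_apply_of_ne _ _ _ _ _ h]; exact Subring.zero_mem _

/-- The matrix of a lifted transvection is integral. [folklore] -/
theorem liftTS_toMatrix_mem {ι : Type*} [DecidableEq ι] (t : Matrix.TransvectionStruct ι 𝓀[F])
    (a b : ι) : (liftTS t).toMatrix a b ∈ 𝒪[F] :=
  transvection_apply_mem_integer_of_mem _ _ (SetLike.coe_mem _) a b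

/-- The matrix of the inverse of a lifted transvection is integral. [folklore] -/
theorem liftTS_inv_toMatrix_mem {ι : Type*} [DecidableEq ι] (t : Matrix.TransvectionStruct ι 𝓀[F])
    (a b : ι) : (liftTS t).inv.toMatrix a b ∈ 𝒪[F] :=
  transvection_apply_mem_integer_of_mem _ _ (Subring.neg_mem _ (SetLike.coe_mem _)) a b

/-- Reduction of a lifted transvection. [folklore] -/
theorem map_resF_liftTS_toMatrix {ι : Type*} [DecidableEq ι] (t : Matrix.TransvectionStruct ι 𝓀[F]) :
    (liftTS t).toMatrix.map resF = t.toMatrix := by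
  rw [liftTS, Matrix.TransvectionStruct.toMatrix_mk, map_resF_transvection, residue_liftRes]
  rfl

/-- Reduction of a product of lifted transvections. [folklore] -/
theorem map_resF_prod_liftTS {ι : Type*} [Fintype ι] [DecidableEq ι]
    (L : List (Matrix.TransvectionStruct ι 𝓀[F])) :
    (((L.map liftTS).map Matrix.TransvectionStruct.toMatrix).prod).map resF =
      (L.map Matrix.TransvectionStruct.toMatrix).prod := by
  rw [map_resF_list_prod _ (fun M hM => ?_)]
  · rw [List.map_map, List.map_map]
    congr 1
    refine List.map_congr_left fun t _ => ?_
    exact map_resF_liftTS_toMatrix t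
  · obtain ⟨t, ht, rfl⟩ := List.mem_map.mp hM
    obtain ⟨t', -, rfl⟩ := List.mem_map.mp ht
    exact liftTS_toMatrix_mem t'

/-! #### Embedding transvections of the unpinned block into `GL_n` -/

variable {S : Finset (Fin n)}

/-- A transvection on the index subtype `{i // i ∉ S}`, viewed as a transvection of `Fin n`.
[folklore] -/
def embTS (t : Matrix.TransvectionStruct {i : Fin n // i ∉ S} F) : Matrix.TransvectionStruct (Fin n) F :=
  ⟨t.i.1, t.j.1, fun h => t.hij (Subtype.ext h), t.c⟩

omit [ValuativeRel F] in
/-- The embedded transvection is `transvection t.i t.j t.c` on `Fin n`. [folklore] -/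
theorem embTS_toMatrix (t : Matrix.TransvectionStruct {i : Fin n // i ∉ S} F) :
    (embTS t).toMatrix = Matrix.transvection (t.i : Fin n) (t.j : Fin n) t.c :=
  rfl

omit [ValuativeRel F] in
/-- The inverse of the embedded transvection is the embedding of the inverse. [folklore] -/
theorem embTS_inv (t : Matrix.TransvectionStruct {i : Fin n // i ∉ S} F) :
    (embTS t).inv = embTS t.inv :=
  rfl

/-- A matrix is **the identity on the rows and columns indexed by `S`**. [folklore] -/
def IsBlockOneOn (S : Finset (Fin n)) (P : Matrix (Fin n) (Fin n) F) : Prop :=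
  ∀ i j, (i ∈ S ∨ j ∈ S) → P i j = (1 : Matrix (Fin n) (Fin n) F) i j

omit [ValuativeRel F] in
/-- The identity is the identity on `S`. [folklore] -/
theorem isBlockOneOn_one (S : Finset (Fin n)) : IsBlockOneOn S (1 : Matrix (Fin n) (Fin n) F) :=
  fun _ _ _ => rfl

omit [ValuativeRel F] in
/-- Products of matrices which are the identity on `S` are the identity on `S`. [folklore] -/
theorem IsBlockOneOn.mul {P Q : Matrix (Fin n) (Fin n) F} (hP : IsBlockOneOn S P) (hQ : IsBlockOneOn S Q) :
    IsBlockOneOn S (P * Q) := by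
  classical
  intro i j hij
  rw [Matrix.mul_apply]
  rcases hij with hi | hj
  · -- row `i ∈ S` of `P` is `e_i`
    rw [Finset.sum_eq_single i (fun l _ hli => by rw [hP i l (Or.inl hi), Matrix.one_apply_ne (Ne.symm hli), zero_mul])
      (fun h => absurd (Finset.mem_univ i) h), hP i i (Or.inl hi), Matrix.one_apply_eq, one_mul,
      hQ i j (Or.inl hi)]
  · rw [Finset.sum_eq_single j (fun l _ hlj => by rw [hQ l j (Or.inr hj), Matrix.one_apply_ne hlj, mul_zero])
      (fun h => absurd (Finset.mem_univ j) h), hQ j j (Or.inr hj), Matrix.one_apply_eq, mul_one,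
      hP i j (Or.inr hj)]

omit [ValuativeRel F] in
/-- An embedded transvection is the identity on `S`. [folklore] -/
theorem isBlockOneOn_embTS_toMatrix (t : Matrix.TransvectionStruct {i : Fin n // i ∉ S} F) :
    IsBlockOneOn S (embTS t).toMatrix := by
  intro i j hij
  rw [embTS_toMatrix, Matrix.transvection, Matrix.add_apply, Matrix.single_apply_of_ne, add_zero]
  rintro ⟨h1, h2⟩
  rcases hij with hi | hj
  · exact t.i.2 (h1 ▸ hi)
  · exact t.j.2 (h2 ▸ hj)

omit [ValuativeRel F] in
/-- A product of a list of matrices which are the identity on `S` is so. [folklore] -/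
theorem isBlockOneOn_list_prod {l : List (Matrix (Fin n) (Fin n) F)} (hl : ∀ M ∈ l, IsBlockOneOn S M) :
    IsBlockOneOn S l.prod := by
  induction l with
  | nil => exact isBlockOneOn_one S
  | cons M l ih =>
    rw [List.prod_cons]
    exact (hl M List.mem_cons_self).mul (ih fun M' hM' => hl M' (List.mem_cons_of_mem M hM'))

omit [ValuativeRel F] in
/-- **A matrix which is the identity on `S` fixes the pinned matrices**: `P D = D` for
`D = gjPin ϖ S a`. [folklore] -/
theorem IsBlockOneOn.mul_gjPin {P : Matrix (Fin n) (Fin n) F} (hP : IsBlockOneOn S P) (a : Fin n → ℕ) :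
    P * gjPin ϖ S a = gjPin ϖ S a := by
  ext i j
  rw [mul_gjPin_apply, gjPin_apply]
  by_cases hj : j ∈ S
  · rw [hP i j (Or.inr hj), Matrix.one_apply]
    by_cases hij : i = j
    · subst hij; simp [hj]
    · simp [hij]
  · by_cases hij : i = j
    · subst hij; simp [hj]
    · simp [hij, hj]

omit [ValuativeRel F] in
/-- `D P = D` for `D = gjPin ϖ S a` and `P` the identity on `S`. [folklore] -/
theorem IsBlockOneOn.gjPin_mul {P : Matrix (Fin n) (Fin n) F} (hP : IsBlockOneOn S P) (a : Fin n → ℕ) :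
    gjPin ϖ S a * P = gjPin ϖ S a := by
  ext i j
  rw [gjPin_mul_apply, gjPin_apply]
  by_cases hi : i ∈ S
  · rw [hP i j (Or.inl hi), Matrix.one_apply]
    by_cases hij : i = j
    · subst hij; simp [hi]
    · simp [hij]
  · by_cases hij : i = j
    · subst hij; simp [hi]
    · simp [hij, hi]

/-- A matrix is **supported on the block `Sᶜ × Sᶜ`**. [folklore] -/
def IsBlockSuppOn (S : Finset (Fin n)) (M : Matrix (Fin n) (Fin n) F) : Prop :=
  ∀ i j, (i ∈ S ∨ j ∈ S) → M i j = 0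

/-- The block `Sᶜ × Sᶜ` of a matrix, as a matrix indexed by `{i // i ∉ S}`. [folklore] -/
def blockOf (S : Finset (Fin n)) (M : Matrix (Fin n) (Fin n) F) :
    Matrix {i : Fin n // i ∉ S} {i : Fin n // i ∉ S} F :=
  M.submatrix Subtype.val Subtype.val

omit [Field F] [ValuativeRel F] in
/-- Entries of `blockOf`. [folklore] -/
@[simp] theorem blockOf_apply (M : Matrix (Fin n) (Fin n) F) (x y : {i : Fin n // i ∉ S}) :
    blockOf S M x y = M x y :=
  rfl

omit [ValuativeRel F] in
/-- **Left action of an embedded transvection on a block-supported matrix**: the product is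
block-supported and its block is the product of the blocks. [folklore] -/
theorem embTS_toMatrix_mul (t : Matrix.TransvectionStruct {i : Fin n // i ∉ S} F)
    {M : Matrix (Fin n) (Fin n) F} (hM : IsBlockSuppOn S M) :
    IsBlockSuppOn S ((embTS t).toMatrix * M) ∧
      blockOf S ((embTS t).toMatrix * M) = t.toMatrix * blockOf S M := by
  classical
  have key : ∀ a b : Fin n, ((embTS t).toMatrix * M) a b =
      M a b + (if a = t.i then t.c * M t.j b else 0) := by
    intro a b
    rw [embTS_toMatrix]
    by_cases ha : a = t.i
    · rw [ha, Matrix.transvection_mul_apply_same, if_pos rfl]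
    · rw [Matrix.transvection_mul_apply_of_ne _ _ _ _ ha, if_neg ha, add_zero]
  refine ⟨fun a b hab => ?_, ?_⟩
  · rw [key]
    rcases hab with ha | hb
    · rw [hM a b (Or.inl ha), if_neg (show ¬ a = (t.i : Fin n) from fun h => t.i.2 (h ▸ ha)),
        add_zero]
    · rw [hM a b (Or.inr hb), hM _ b (Or.inr hb), mul_zero, ite_self, add_zero]
  · ext x y
    rw [blockOf_apply, key, Matrix.TransvectionStruct.toMatrix]
    by_cases hx : x = t.i
    · subst hx
      rw [if_pos rfl, Matrix.transvection_mul_apply_same, blockOf_apply, blockOf_apply]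
    · rw [if_neg (fun h => hx (Subtype.ext h)), Matrix.transvection_mul_apply_of_ne _ _ _ _ hx,
        add_zero, blockOf_apply]

omit [ValuativeRel F] in
/-- **Right action of an embedded transvection on a block-supported matrix.** [folklore] -/
theorem mul_embTS_toMatrix (t : Matrix.TransvectionStruct {i : Fin n // i ∉ S} F)
    {M : Matrix (Fin n) (Fin n) F} (hM : IsBlockSuppOn S M) :
    IsBlockSuppOn S (M * (embTS t).toMatrix) ∧
      blockOf S (M * (embTS t).toMatrix) = blockOf S M * t.toMatrix := by
  classical
  have key : ∀ a b : Fin n, (M * (embTS t).toMatrix) a b =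
      M a b + (if b = t.j then t.c * M a t.i else 0) := by
    intro a b
    rw [embTS_toMatrix]
    by_cases hb : b = t.j
    · rw [hb, Matrix.mul_transvection_apply_same, if_pos rfl]
    · rw [Matrix.mul_transvection_apply_of_ne _ _ _ _ hb, if_neg hb, add_zero]
  refine ⟨fun a b hab => ?_, ?_⟩
  · rw [key]
    rcases hab with ha | hb
    · rw [hM a b (Or.inl ha), hM a _ (Or.inl ha), mul_zero, ite_self, add_zero]
    · rw [hM a b (Or.inr hb), if_neg (show ¬ b = (t.j : Fin n) from fun h => t.j.2 (h ▸ hb)),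
        add_zero]
  · ext x y
    rw [blockOf_apply, key, Matrix.TransvectionStruct.toMatrix]
    by_cases hy : y = t.j
    · subst hy
      rw [if_pos rfl, Matrix.mul_transvection_apply_same, blockOf_apply, blockOf_apply]
    · rw [if_neg (fun h => hy (Subtype.ext h)), Matrix.mul_transvection_apply_of_ne _ _ _ _ hy,
        add_zero, blockOf_apply]

omit [ValuativeRel F] in
/-- Left action of a product of embedded transvections on a block-supported matrix. [folklore] -/
theorem prod_embTS_mul (L : List (Matrix.TransvectionStruct {i : Fin n // i ∉ S} F))
    {M : Matrix (Fin n) (Fin n) F} (hM : IsBlockSuppOn S M) :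
    IsBlockSuppOn S (((L.map embTS).map Matrix.TransvectionStruct.toMatrix).prod * M) ∧
      blockOf S (((L.map embTS).map Matrix.TransvectionStruct.toMatrix).prod * M) =
        (L.map Matrix.TransvectionStruct.toMatrix).prod * blockOf S M := by
  induction L with
  | nil => simp [hM]
  | cons t L ih =>
    rw [List.map_cons, List.map_cons, List.prod_cons, List.map_cons, List.prod_cons,
      Matrix.mul_assoc, Matrix.mul_assoc]
    have h := embTS_toMatrix_mul t ih.1
    exact ⟨h.1, by rw [h.2, ih.2]⟩

omit [ValuativeRel F] in
/-- Right action of a product of embedded transvections on a block-supported matrix. [folklore] -/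
theorem mul_prod_embTS (L : List (Matrix.TransvectionStruct {i : Fin n // i ∉ S} F))
    {M : Matrix (Fin n) (Fin n) F} (hM : IsBlockSuppOn S M) :
    IsBlockSuppOn S (M * ((L.map embTS).map Matrix.TransvectionStruct.toMatrix).prod) ∧
      blockOf S (M * ((L.map embTS).map Matrix.TransvectionStruct.toMatrix).prod) =
        blockOf S M * (L.map Matrix.TransvectionStruct.toMatrix).prod := by
  induction L generalizing M with
  | nil => simp [hM]
  | cons t L ih =>
    rw [List.map_cons, List.map_cons, List.prod_cons, List.map_cons, List.prod_cons,
      ← Matrix.mul_assoc, ← Matrix.mul_assoc]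
    have h := mul_embTS_toMatrix t hM
    have h' := ih h.1
    exact ⟨h'.1, by rw [h'.2, h.2]⟩

omit [ValuativeRel F] in
/-- **The unit of `GL_n` attached to a list of transvections** (its inverse is the reversed list
of inverse transvections). [folklore] -/
def unitOfTransvections {ι : Type*} [Fintype ι] [DecidableEq ι] {R : Type*} [CommRing R]
    (L : List (Matrix.TransvectionStruct ι R)) : (Matrix ι ι R)ˣ :=
  ⟨(L.map Matrix.TransvectionStruct.toMatrix).prod,
    (L.reverse.map (Matrix.TransvectionStruct.toMatrix ∘ Matrix.TransvectionStruct.inv)).prod,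
    Matrix.TransvectionStruct.prod_mul_reverse_inv_prod L,
    Matrix.TransvectionStruct.reverse_inv_prod_mul_prod L⟩

omit [ValuativeRel F] in
/-- The matrix of `unitOfTransvections`. [folklore] -/
theorem coe_unitOfTransvections {ι : Type*} [Fintype ι] [DecidableEq ι] {R : Type*} [CommRing R]
    (L : List (Matrix.TransvectionStruct ι R)) :
    ((unitOfTransvections L : (Matrix ι ι R)ˣ) : Matrix ι ι R) =
      (L.map Matrix.TransvectionStruct.toMatrix).prod :=
  rfl

omit [ValuativeRel F] in
/-- The matrix of the inverse of `unitOfTransvections`. [folklore] -/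
theorem coe_unitOfTransvections_inv {ι : Type*} [Fintype ι] [DecidableEq ι] {R : Type*} [CommRing R]
    (L : List (Matrix.TransvectionStruct ι R)) :
    (((unitOfTransvections L)⁻¹ : (Matrix ι ι R)ˣ) : Matrix ι ι R) =
      ((L.reverse.map Matrix.TransvectionStruct.inv).map Matrix.TransvectionStruct.toMatrix).prod := by
  rw [List.map_map]
  rfl

omit [ValuativeRel F] in
/-- A product of a list of integral matrices is integral. [folklore] -/
theorem isIntegralMatrix_list_prod [ValuativeRel F] {l : List (Matrix (Fin n) (Fin n) F)}
    (hl : ∀ M ∈ l, IsIntegralMatrix M) : IsIntegralMatrix l.prod := by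
  induction l with
  | nil => rw [List.prod_nil]; exact IsIntegralMatrix.one
  | cons M l ih =>
    rw [List.prod_cons]
    exact (hl M List.mem_cons_self).mul (ih fun M' hM' => hl M' (List.mem_cons_of_mem M hM'))

/-- **The lifted elimination matrices**: for a list `L` of transvections of the block `Sᶜ` over the
residue field, the unit `P = ∏ (lifted, embedded transvections) ∈ GL_n(F)` lies in `GL_n(𝒪)` and is
the identity on `S` together with its inverse. [folklore] -/
theorem unitOfTransvections_embTS_liftTS_props
    (L : List (Matrix.TransvectionStruct {i : Fin n // i ∉ S} 𝓀[F])) :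
    (unitOfTransvections ((L.map liftTS).map embTS) : GL (Fin n) F) ∈ glInt n F ∧
      IsBlockOneOn S ((unitOfTransvections ((L.map liftTS).map embTS) : GL (Fin n) F) :
        Matrix (Fin n) (Fin n) F) ∧
      IsBlockOneOn S (((unitOfTransvections ((L.map liftTS).map embTS))⁻¹ : GL (Fin n) F) :
        Matrix (Fin n) (Fin n) F) := by
  have hfac : ∀ M ∈ ((L.map liftTS).map embTS).map Matrix.TransvectionStruct.toMatrix,
      IsIntegralMatrix M ∧ IsBlockOneOn S M := by
    intro M hM
    obtain ⟨t, ht, rfl⟩ := List.mem_map.mp hM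
    obtain ⟨t', ht', rfl⟩ := List.mem_map.mp ht
    obtain ⟨t'', -, rfl⟩ := List.mem_map.mp ht'
    refine ⟨fun a b => ?_, isBlockOneOn_embTS_toMatrix _⟩
    rw [embTS_toMatrix]
    exact transvection_apply_mem_integer_of_mem _ _ (SetLike.coe_mem _) a b
  have hfac' : ∀ M ∈ (((L.map liftTS).map embTS).reverse.map Matrix.TransvectionStruct.inv).map
      Matrix.TransvectionStruct.toMatrix, IsIntegralMatrix M ∧ IsBlockOneOn S M := by
    intro M hM
    obtain ⟨t, ht, rfl⟩ := List.mem_map.mp hM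
    obtain ⟨t₁, ht₁, rfl⟩ := List.mem_map.mp ht
    rw [List.mem_reverse] at ht₁
    obtain ⟨t', ht', rfl⟩ := List.mem_map.mp ht₁
    obtain ⟨t'', -, rfl⟩ := List.mem_map.mp ht'
    rw [embTS_inv]
    refine ⟨fun a b => ?_, isBlockOneOn_embTS_toMatrix _⟩
    rw [embTS_toMatrix]
    exact transvection_apply_mem_integer_of_mem _ _ (Subring.neg_mem _ (SetLike.coe_mem _)) a b
  have hint : IsIntegralMatrix ((unitOfTransvections ((L.map liftTS).map embTS) : GL (Fin n) F) :
      Matrix (Fin n) (Fin n) F) := by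
    rw [coe_unitOfTransvections]
    exact isIntegralMatrix_list_prod fun M hM => (hfac M hM).1
  have hint' : IsIntegralMatrix (((unitOfTransvections ((L.map liftTS).map embTS))⁻¹ : GL (Fin n) F) :
      Matrix (Fin n) (Fin n) F) := by
    rw [coe_unitOfTransvections_inv]
    exact isIntegralMatrix_list_prod fun M hM => (hfac' M hM).1
  refine ⟨(mem_glInt_iff _).mpr ⟨hint, hint'⟩, ?_, ?_⟩
  · rw [coe_unitOfTransvections]
    exact isBlockOneOn_list_prod fun M hM => (hfac M hM).2
  · rw [coe_unitOfTransvections_inv]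
    exact isBlockOneOn_list_prod fun M hM => (hfac' M hM).2

/-- The chosen lift of a non-zero residue has valuation `1`. [folklore] -/
theorem valuation_liftRes_eq_one {c : 𝓀[F]} (hc : c ≠ 0) :
    valuation F ((liftRes c : 𝒪[F]) : F) = 1 := by
  refine le_antisymm ((Valuation.mem_integer_iff _ _).mp (SetLike.coe_mem _)) ?_
  by_contra hlt
  rw [not_le] at hlt
  exact hc (by rw [← residue_liftRes c, residue_eq_zero_of_valuation_lt_one hlt])

/-- **Gaussian elimination modulo `ϖ` on the unpinned block.** Let `W` be an integral matrix
supported on `Sᶜ × Sᶜ`. There are `P, Q, Δ ∈ GL_n(𝒪)` which are the identity on the rows and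
columns indexed by `S` (`P⁻¹`, `Q⁻¹` as well; `Δ` is diagonal with unit entries), and a set
`T ⊆ Sᶜ`, such that `P W Q ≡ Δ · diag(𝟙_T) (mod ϖ)` entrywise; and `T = ∅` forces
`W ≡ 0 (mod ϖ)`. Proof: reduce the block `W̄|_{Sᶜ × Sᶜ}` over the residue field to a diagonal
matrix `diag(d)` by transvections (Mathlib's `Matrix.Pivot`), lift the transvections to
integral transvections of `GL_n(F)` with indices in `Sᶜ`, let `T = {d ≠ 0}` and `Δ` the diagonal
matrix of lifts of the non-zero `d_i` (and `1` elsewhere). [folklore] -/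
theorem exists_blockElim (S : Finset (Fin n)) {W : Matrix (Fin n) (Fin n) F}
    (hWint : IsIntegralMatrix W) (hWsupp : IsBlockSuppOn S W) :
    ∃ P Q Δ : GL (Fin n) F, P ∈ glInt n F ∧ Q ∈ glInt n F ∧ Δ ∈ glInt n F ∧
      IsBlockOneOn S (P : Matrix (Fin n) (Fin n) F) ∧
      IsBlockOneOn S ((P⁻¹ : GL (Fin n) F) : Matrix (Fin n) (Fin n) F) ∧
      IsBlockOneOn S (Q : Matrix (Fin n) (Fin n) F) ∧
      IsBlockOneOn S ((Q⁻¹ : GL (Fin n) F) : Matrix (Fin n) (Fin n) F) ∧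
      IsBlockOneOn S (Δ : Matrix (Fin n) (Fin n) F) ∧
      ∃ T : Finset (Fin n), (∀ i ∈ T, i ∉ S) ∧
        (∀ i j, valuation F (((P : Matrix (Fin n) (Fin n) F) * W * (Q : Matrix (Fin n) (Fin n) F) -
          (Δ : Matrix (Fin n) (Fin n) F) *
            Matrix.diagonal (fun i => if i ∈ T then (1 : F) else 0)) i j) < 1) ∧
        (T = ∅ → ∀ i j, valuation F (W i j) < 1) := by
  classical
  -- the reduced block and its diagonalisation over the residue field
  set Wb : Matrix {i : Fin n // i ∉ S} {i : Fin n // i ∉ S} 𝓀[F] := (blockOf S W).map resF with hWb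
  obtain ⟨L, L', d, hLL'⟩ :=
    Matrix.Pivot.exists_list_transvec_mul_mul_list_transvec_eq_diagonal Wb
  set P : GL (Fin n) F := unitOfTransvections ((L.map liftTS).map embTS) with hPdef
  set Q : GL (Fin n) F := unitOfTransvections ((L'.map liftTS).map embTS) with hQdef
  obtain ⟨hPint, hPone, hPinvone⟩ := unitOfTransvections_embTS_liftTS_props (S := S) L
  obtain ⟨hQint, hQone, hQinvone⟩ := unitOfTransvections_embTS_liftTS_props (S := S) L'
  -- the pins found: `T = {d ≠ 0}` and the diagonal unit matrix `Δ`
  set T : Finset (Fin n) := Finset.univ.filter fun i => ∃ h : i ∉ S, d ⟨i, h⟩ ≠ 0 with hTdef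
  set δ : Fin n → F := fun i => if h : i ∉ S then
    (if d ⟨i, h⟩ ≠ 0 then ((liftRes (d ⟨i, h⟩) : 𝒪[F]) : F) else 1) else 1 with hδdef
  have hδv : ∀ i, valuation F (δ i) = 1 := by
    intro i
    by_cases h1 : i ∉ S
    · by_cases h2 : d ⟨i, h1⟩ ≠ 0
      · simp only [hδdef, dif_pos h1, if_pos h2]; exact valuation_liftRes_eq_one h2
      · simp only [hδdef, dif_pos h1, if_neg h2]; exact (valuation F).map_one
    · simp only [hδdef, dif_neg h1]; exact (valuation F).map_one
  have hδ0 : ∀ i, δ i ≠ 0 := fun i h => by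
    have := hδv i; rw [h, map_zero] at this; exact zero_ne_one this
  have hdet : IsUnit (Matrix.diagonal δ).det := by
    rw [Matrix.det_diagonal]
    exact isUnit_iff_ne_zero.mpr (Finset.prod_ne_zero_iff.mpr fun i _ => hδ0 i)
  set Δ : GL (Fin n) F := Matrix.GeneralLinearGroup.mk'' (Matrix.diagonal δ) hdet with hΔdef
  have hΔcoe : ((Δ : GL (Fin n) F) : Matrix (Fin n) (Fin n) F) = Matrix.diagonal δ := rfl
  have hΔint : Δ ∈ glInt n F := by
    refine mem_glInt_of_isIntegralMatrix (fun i j => ?_) ?_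
    · rw [hΔcoe, Matrix.diagonal_apply]
      split_ifs
      · exact (Valuation.mem_integer_iff _ _).mpr (hδv i).le
      · exact Subring.zero_mem _
    · rw [hΔcoe, Matrix.det_diagonal, map_prod]
      exact Finset.prod_eq_one fun i _ => hδv i
  have hΔone : IsBlockOneOn S ((Δ : GL (Fin n) F) : Matrix (Fin n) (Fin n) F) := by
    intro i j hij
    rw [hΔcoe, Matrix.diagonal_apply, Matrix.one_apply]
    split_ifs with h
    · subst h
      have hi : i ∈ S := by rcases hij with h | h <;> exact h
      simp only [hδdef, dif_neg (not_not.mpr hi)]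
    · rfl
  refine ⟨P, Q, Δ, hPint, hQint, hΔint, hPone, hPinvone, hQone, hQinvone, hΔone, T,
    fun i hi => ?_, ?_, ?_⟩
  · obtain ⟨h, -⟩ := (Finset.mem_filter.mp hi).2
    exact h
  · -- the block of `P W Q` is `∏ L̃ · W|block · ∏ L̃'`, with reduction `diag(d)`
    have h1 := prod_embTS_mul (L.map liftTS) hWsupp
    have h2 := mul_prod_embTS (L'.map liftTS) h1.1
    rw [h1.2] at h2
    have hPWQsupp : IsBlockSuppOn S ((P : Matrix (Fin n) (Fin n) F) * W * (Q : Matrix (Fin n) (Fin n) F)) := by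
      rw [hPdef, hQdef, coe_unitOfTransvections, coe_unitOfTransvections]; exact h2.1
    have hPWQblock : blockOf S ((P : Matrix (Fin n) (Fin n) F) * W * (Q : Matrix (Fin n) (Fin n) F)) =
        ((L.map liftTS).map Matrix.TransvectionStruct.toMatrix).prod * blockOf S W *
          ((L'.map liftTS).map Matrix.TransvectionStruct.toMatrix).prod := by
      rw [hPdef, hQdef, coe_unitOfTransvections, coe_unitOfTransvections]; exact h2.2
    have hLint : ∀ x y, ((L.map liftTS).map Matrix.TransvectionStruct.toMatrix).prod x y ∈ 𝒪[F] :=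
      list_prod_apply_mem_integer _ fun M hM => by
        obtain ⟨t, ht, rfl⟩ := List.mem_map.mp hM
        obtain ⟨t', -, rfl⟩ := List.mem_map.mp ht
        exact liftTS_toMatrix_mem t'
    have hL'int : ∀ x y, ((L'.map liftTS).map Matrix.TransvectionStruct.toMatrix).prod x y ∈ 𝒪[F] :=
      list_prod_apply_mem_integer _ fun M hM => by
        obtain ⟨t, ht, rfl⟩ := List.mem_map.mp hM
        obtain ⟨t', -, rfl⟩ := List.mem_map.mp ht
        exact liftTS_toMatrix_mem t'
    have hWbint : ∀ x y, blockOf S W x y ∈ 𝒪[F] := fun x y => hWint x y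
    have hLWint : ∀ x y, (((L.map liftTS).map Matrix.TransvectionStruct.toMatrix).prod * blockOf S W) x y ∈
        𝒪[F] := by
      intro x y
      rw [Matrix.mul_apply]
      exact Subring.sum_mem _ fun l _ => Subring.mul_mem _ (hLint x l) (hWbint l y)
    have hred : (blockOf S ((P : Matrix (Fin n) (Fin n) F) * W * (Q : Matrix (Fin n) (Fin n) F))).map resF =
        Matrix.diagonal d := by
      rw [hPWQblock, map_resF_mul hLWint hL'int, map_resF_mul hLint hWbint, map_resF_prod_liftTS,
        map_resF_prod_liftTS, ← hWb, hLL']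
    intro i j
    by_cases hblock : i ∉ S ∧ j ∉ S
    · obtain ⟨hi, hj⟩ := hblock
      -- compare residues inside the block
      have hint1 : ((P : Matrix (Fin n) (Fin n) F) * W * (Q : Matrix (Fin n) (Fin n) F)) i j ∈ 𝒪[F] := by
        have := congrFun (congrFun hPWQblock ⟨i, hi⟩) ⟨j, hj⟩
        rw [blockOf_apply] at this
        rw [this, Matrix.mul_apply]
        exact Subring.sum_mem _ fun l _ => Subring.mul_mem _ (hLWint _ l) (hL'int l _)
      have hint2 : (((Δ : GL (Fin n) F) : Matrix (Fin n) (Fin n) F) *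
          Matrix.diagonal (fun i => if i ∈ T then (1 : F) else 0)) i j ∈ 𝒪[F] := by
        rw [hΔcoe, Matrix.diagonal_mul_diagonal, Matrix.diagonal_apply]
        by_cases hij : i = j
        · rw [if_pos hij]
          refine Subring.mul_mem _ ((Valuation.mem_integer_iff _ _).mpr (hδv i).le) ?_
          by_cases hT : i ∈ T
          · rw [if_pos hT]; exact Subring.one_mem _
          · rw [if_neg hT]; exact Subring.zero_mem _
        · rw [if_neg hij]; exact Subring.zero_mem _
      refine valuation_sub_lt_one_of_resF_eq hint1 hint2 ?_
      have hres1 : resF (((P : Matrix (Fin n) (Fin n) F) * W * (Q : Matrix (Fin n) (Fin n) F)) i j) =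
          Matrix.diagonal d ⟨i, hi⟩ ⟨j, hj⟩ := by
        have := congrFun (congrFun hred ⟨i, hi⟩) ⟨j, hj⟩
        rwa [Matrix.map_apply, blockOf_apply] at this
      rw [hres1, hΔcoe, Matrix.diagonal_mul_diagonal, Matrix.diagonal_apply, Matrix.diagonal_apply]
      by_cases hij : i = j
      · subst hij
        simp only [if_true, hδdef, dif_pos hi]
        by_cases hd : d ⟨i, hi⟩ ≠ 0
        · have hiT : i ∈ T := Finset.mem_filter.mpr ⟨Finset.mem_univ _, hi, hd⟩
          rw [if_pos hd, if_pos hiT, mul_one, resF_liftRes]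
        · have hiT : i ∉ T := fun h => by
            obtain ⟨-, h', hd'⟩ := Finset.mem_filter.mp h
            exact hd hd'
          rw [if_neg hd, if_neg hiT, mul_zero, resF_zero, not_not.mp hd]
      · rw [if_neg (fun h => hij (congrArg Subtype.val h)), if_neg hij, resF_zero]
    · -- outside the block both matrices vanish
      have hij : i ∈ S ∨ j ∈ S := by
        by_cases hi : i ∈ S
        · exact Or.inl hi
        · exact Or.inr (by by_contra hj; exact hblock ⟨hi, hj⟩)
      rw [Matrix.sub_apply, hPWQsupp i j hij, hΔcoe, Matrix.diagonal_mul_diagonal, Matrix.diagonal_apply]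
      have hzero : (if i = j then δ i * (if i ∈ T then (1 : F) else 0) else 0) = 0 := by
        by_cases h1 : i = j
        · rw [if_pos h1]
          by_cases h2 : i ∈ T
          · obtain ⟨h, -⟩ := (Finset.mem_filter.mp h2).2
            subst h1
            exact absurd (by rcases hij with h' | h' <;> exact h') h
          · rw [if_neg h2, mul_zero]
        · rw [if_neg h1]
      rw [hzero, sub_zero, map_zero]
      exact zero_lt_one
  · -- `T = ∅`: all `d = 0`, so the reduced block vanishes and `W ≡ 0`
    intro hT i j
    by_cases hblock : i ∉ S ∧ j ∉ S
    · obtain ⟨hi, hj⟩ := hblock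
      have hd0 : ∀ x : {i : Fin n // i ∉ S}, d x = 0 := by
        intro x
        by_contra hx
        have : (x : Fin n) ∈ T := Finset.mem_filter.mpr ⟨Finset.mem_univ _, x.2, hx⟩
        rw [hT] at this
        exact absurd this (Finset.notMem_empty _)
      have hdiag : Matrix.diagonal d = 0 := by
        ext x y; simp [Matrix.diagonal_apply, hd0]
      have hWb0 : Wb = 0 := by
        have h : Wb = (L.reverse.map (Matrix.TransvectionStruct.toMatrix ∘
            Matrix.TransvectionStruct.inv)).prod *
            ((L.map Matrix.TransvectionStruct.toMatrix).prod * Wb *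
              (L'.map Matrix.TransvectionStruct.toMatrix).prod) *
            (L'.reverse.map (Matrix.TransvectionStruct.toMatrix ∘ Matrix.TransvectionStruct.inv)).prod := by
          rw [Matrix.mul_assoc, Matrix.mul_assoc, Matrix.TransvectionStruct.prod_mul_reverse_inv_prod,
            Matrix.mul_one, ← Matrix.mul_assoc, Matrix.TransvectionStruct.reverse_inv_prod_mul_prod,
            Matrix.one_mul]
        rw [hLL', hdiag, Matrix.mul_zero, Matrix.zero_mul] at h
        exact h
      have : resF (W i j) = 0 := by
        have h := congrFun (congrFun hWb0 ⟨i, hi⟩) ⟨j, hj⟩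
        rwa [hWb, Matrix.map_apply, blockOf_apply] at h
      exact (resF_eq_zero_iff (hWint i j)).mp this
    · have hij : i ∈ S ∨ j ∈ S := by
        by_cases hi : i ∈ S
        · exact Or.inl hi
        · exact Or.inr (by by_contra hj; exact hblock ⟨hi, hj⟩)
      rw [hWsupp i j hij, map_zero]
      exact zero_lt_one

end Transvections

/-! ### The dichotomy at the next precision -/

section Dichotomy

variable {m N c : ℕ} {S : Finset (Fin n)} {a : Fin n → ℕ}

/-- `|ϖ|^k ≠ 0`. [folklore] -/
theorem valuation_pow_ne_zero' (hϖ0 : ϖ ≠ 0) (k : ℕ) : valuation F ϖ ^ k ≠ 0 :=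
  pow_ne_zero _ ((Valuation.ne_zero_iff _).mpr hϖ0)

/-- **The two unipotent corrections.** Let `D = gjPin ϖ S a` with `a_i + c ≤ N` on `S` (`c ≥ 1`) and
`Z'` integral. There are `L, R ∈ K_c` (`L = 1 + C`, `C` supported on `Sᶜ × S` with
`C_{ij} = ϖ^N Z'_{ij} ϖ^{-a_j}`; `R = 1 + B`, `B` supported on the rows in `S` with
`B_{ij} = ϖ^{N - a_i} Z'_{ij}`) such that
`D + ϖ^N Z' - L D R ≡ ϖ^N W (mod ϖ^{N+1})`, `W` the block `Sᶜ × Sᶜ` of `Z'`: indeed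
`L D R = D + D B + C D + C D B`, `D B + C D` is `ϖ^N Z'` off the block and `|C D B| ≤ |ϖ|^{N + c}`.
[folklore] -/
theorem exists_corrections_gjPin_add (hϖ : IsUniformizingElement ϖ) (hc : 1 ≤ c)
    (hgap : ∀ i ∈ S, a i + c ≤ N) {Z' : Matrix (Fin n) (Fin n) F} (hZ' : IsIntegralMatrix Z') :
    ∃ L R : GL (Fin n) F, L ∈ congruenceGL n (valuation F ϖ ^ c) ∧ R ∈ congruenceGL n (valuation F ϖ ^ c) ∧
      ValBound (valuation F ϖ ^ (N + 1))
        (gjPin ϖ S a + ϖ ^ N • Z' - (L : Matrix (Fin n) (Fin n) F) * gjPin ϖ S a * (R : Matrix (Fin n) (Fin n) F) -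
          ϖ ^ N • Matrix.of (fun i j => if i ∉ S ∧ j ∉ S then Z' i j else 0)) := by
  classical
  have hϖ0 := hϖ.ne_zero
  have hϖle : valuation F ϖ ≤ 1 := hϖ.valuation_le_one
  set D := gjPin ϖ S a with hD
  -- the integral matrices `C̃`, `B̃` with `C = ϖ^c C̃`, `B = ϖ^c B̃`
  set Ct : Matrix (Fin n) (Fin n) F := Matrix.of fun i j =>
    if i ∉ S ∧ j ∈ S then ϖ ^ (N - a j - c) * Z' i j else 0 with hCt
  set Bt : Matrix (Fin n) (Fin n) F := Matrix.of fun i j =>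
    if i ∈ S then ϖ ^ (N - a i - c) * Z' i j else 0 with hBt
  have hCtint : IsIntegralMatrix Ct := by
    intro i j; rw [hCt, Matrix.of_apply]
    split_ifs
    · exact Subring.mul_mem _ (hϖ.pow_mem _) (hZ' i j)
    · exact Subring.zero_mem _
  have hBtint : IsIntegralMatrix Bt := by
    intro i j; rw [hBt, Matrix.of_apply]
    split_ifs
    · exact Subring.mul_mem _ (hϖ.pow_mem _) (hZ' i j)
    · exact Subring.zero_mem _
  set L : GL (Fin n) F := Matrix.GeneralLinearGroup.mk'' (1 + ϖ ^ c • Ct)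
    (isUnit_det_one_add_smul hϖ hc hCtint) with hLdef
  set R : GL (Fin n) F := Matrix.GeneralLinearGroup.mk'' (1 + ϖ ^ c • Bt)
    (isUnit_det_one_add_smul hϖ hc hBtint) with hRdef
  set C : Matrix (Fin n) (Fin n) F := ϖ ^ c • Ct with hCdef
  set B : Matrix (Fin n) (Fin n) F := ϖ ^ c • Bt with hBdef
  set W : Matrix (Fin n) (Fin n) F :=
    ϖ ^ N • Matrix.of (fun i j => if i ∉ S ∧ j ∉ S then Z' i j else 0) with hWdef
  have hLcoe : ((L : GL (Fin n) F) : Matrix (Fin n) (Fin n) F) = 1 + C := rfl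
  have hRcoe : ((R : GL (Fin n) F) : Matrix (Fin n) (Fin n) F) = 1 + B := rfl
  refine ⟨L, R, mk''_one_add_smul_mem_congruenceGL hϖ hc hCtint,
    mk''_one_add_smul_mem_congruenceGL hϖ hc hBtint, ?_⟩
  -- `D B = ϖ^N Z'` on the rows in `S`, `C D = ϖ^N Z'` on `Sᶜ × S`
  have hDB : ∀ i j, (D * B) i j = if i ∈ S then ϖ ^ N * Z' i j else 0 := by
    intro i j
    rw [hBdef, Matrix.mul_smul, Matrix.smul_apply, hD, gjPin_mul_apply, hBt, Matrix.of_apply,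
      smul_eq_mul]
    by_cases hi : i ∈ S
    · rw [if_pos hi, if_pos hi, if_pos hi, ← mul_assoc, ← mul_assoc, ← pow_add, ← pow_add]
      congr 2
      have := hgap i hi
      omega
    · rw [if_neg hi, if_neg hi, zero_mul, mul_zero, if_neg hi]
  have hCD : ∀ i j, (C * D) i j = if i ∉ S ∧ j ∈ S then ϖ ^ N * Z' i j else 0 := by
    intro i j
    rw [hCdef, Matrix.smul_mul, Matrix.smul_apply, hD, mul_gjPin_apply, hCt, Matrix.of_apply,
      smul_eq_mul]
    by_cases h : i ∉ S ∧ j ∈ S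
    · rw [if_pos h, if_pos h.2, if_pos h, mul_assoc, mul_comm (Z' i j), ← mul_assoc, ← mul_assoc,
        ← pow_add, ← pow_add]
      congr 2
      have := hgap j h.2
      omega
    · rw [if_neg h, zero_mul, mul_zero, if_neg h]
  -- the masking identity
  have hmask : ϖ ^ N • Z' - D * B - C * D - W = 0 := by
    ext i j
    simp only [hWdef, Matrix.sub_apply, Matrix.smul_apply, smul_eq_mul, Matrix.of_apply, hDB, hCD,
      Matrix.zero_apply]
    by_cases hi : i ∈ S
    · simp [hi]
    · by_cases hj : j ∈ S
      · simp [hi, hj]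
      · simp [hi, hj]
  -- the error term `C D B` is small
  have hCDB : ValBound (valuation F ϖ ^ (N + 1)) (C * D * B) := by
    have h1 : ValBound (valuation F ϖ ^ c) C := by
      intro i j
      rw [hCdef, Matrix.smul_apply, smul_eq_mul, map_mul, map_pow]
      exact (mul_le_mul' le_rfl ((Valuation.mem_integer_iff _ _).mp (hCtint i j))).trans
        (le_of_eq (mul_one _))
    have h2 : ValBound (valuation F ϖ ^ N) (D * B) := by
      intro i j
      rw [hDB]
      split_ifs
      · rw [map_mul, map_pow]
        exact (mul_le_mul' le_rfl ((Valuation.mem_integer_iff _ _).mp (hZ' i j))).trans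
          (le_of_eq (mul_one _))
      · rw [map_zero]; exact zero_le
    have h3 := h1.mul h2
    rw [← Matrix.mul_assoc] at h3
    refine h3.mono ?_
    rw [← pow_add, add_comm]
    exact pow_le_pow_right_of_le_one' hϖle (by omega)
  -- assemble
  have e : D + ϖ ^ N • Z' - (L : Matrix (Fin n) (Fin n) F) * D * (R : Matrix (Fin n) (Fin n) F) - W =
      (ϖ ^ N • Z' - D * B - C * D - W) - C * D * B := by
    rw [hLcoe, hRcoe]
    noncomm_ring
  rw [e, hmask, zero_sub]
  exact hCDB.neg

/-- **The dichotomy, first case: the unpinned block is divisible by `ϖ`.** With `D`, `Z'`, `c` as in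
`exists_corrections_gjPin_add`, if the block `Sᶜ × Sᶜ` of `Z'` has entries of valuation `≤ |ϖ|`, then
`D + ϖ^N Z' ∈ gjClass ϖ m (N+1) (L D R)` for the corrections `L, R ∈ K_c`; in particular (taking
`c = m`) `D + ϖ^N Z' ∈ gjClass ϖ m (N+1) D` when `a_i + m ≤ N` on `S`. [folklore] -/
theorem exists_mem_gjClass_succ_of_block_small (hϖ : IsUniformizingElement ϖ) (hc : 1 ≤ c)
    (hgap : ∀ i ∈ S, a i + c ≤ N) {Z' : Matrix (Fin n) (Fin n) F} (hZ' : IsIntegralMatrix Z')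
    (hsmall : ∀ i ∉ S, ∀ j ∉ S, valuation F (Z' i j) ≤ valuation F ϖ) (m : ℕ) :
    ∃ L R : GL (Fin n) F, L ∈ congruenceGL n (valuation F ϖ ^ c) ∧ R ∈ congruenceGL n (valuation F ϖ ^ c) ∧
      gjPin ϖ S a + ϖ ^ N • Z' ∈
        gjClass ϖ m (N + 1) ((L : Matrix (Fin n) (Fin n) F) * gjPin ϖ S a * (R : Matrix (Fin n) (Fin n) F)) := by
  obtain ⟨L, R, hL, hR, h⟩ := exists_corrections_gjPin_add hϖ hc hgap hZ'
  refine ⟨L, R, hL, hR, mem_gjClass_of_valBound_sub ?_⟩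
  have hW : ValBound (valuation F ϖ ^ (N + 1))
      (ϖ ^ N • Matrix.of (fun i j => if i ∉ S ∧ j ∉ S then Z' i j else 0)) := by
    intro i j
    rw [Matrix.smul_apply, smul_eq_mul, Matrix.of_apply]
    split_ifs with hij
    · rw [map_mul, map_pow, pow_succ]
      exact mul_le_mul' le_rfl (hsmall i hij.1 j hij.2)
    · rw [mul_zero, map_zero]; exact zero_le
  have := h.add hW
  rwa [sub_add_cancel] at this

/-- The first case of the dichotomy with `c = m`: `D + ϖ^N Z' ∈ gjClass ϖ m (N+1) D`. [folklore] -/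
theorem mem_gjClass_succ_of_block_small (hϖ : IsUniformizingElement ϖ) (hm : 1 ≤ m)
    (hgap : ∀ i ∈ S, a i + m ≤ N) {Z' : Matrix (Fin n) (Fin n) F} (hZ' : IsIntegralMatrix Z')
    (hsmall : ∀ i ∉ S, ∀ j ∉ S, valuation F (Z' i j) ≤ valuation F ϖ) :
    gjPin ϖ S a + ϖ ^ N • Z' ∈ gjClass ϖ m (N + 1) (gjPin ϖ S a) := by
  obtain ⟨L, R, hL, hR, h⟩ := exists_mem_gjClass_succ_of_block_small hϖ hm hgap hZ' hsmall m
  rwa [gjClass_eq_of_mem (coe_mul_mul_coe_mem_gjClass m (N + 1) _ hL hR)] at h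

/-- Scaling an entrywise bound by `ϖ^N`. [folklore] -/
theorem ValBound.pow_smul {γ : ValueGroupWithZero F} {X : Matrix (Fin n) (Fin n) F} (h : ValBound γ X) (N : ℕ) :
    ValBound (valuation F ϖ ^ N * γ) (ϖ ^ N • X) := fun i j => by
  rw [Matrix.smul_apply, smul_eq_mul, map_mul, map_pow]
  exact mul_le_mul' le_rfl (h i j)

/-- An integral matrix with entries of valuation `< 1` has entries of valuation `≤ |ϖ|`
(`ϖ` a uniformizing element). [folklore] -/
theorem valBound_uniformizer_of_lt_one (hϖ : IsUniformizingElement ϖ) {X : Matrix (Fin n) (Fin n) F}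
    (hX : ValBound 1 X) (hlt : ∀ i j, valuation F (X i j) < 1) : ValBound (valuation F ϖ) X :=
  fun i j => (valuation_lt_one_iff_le_uniformizer hϖ ((Valuation.mem_integer_iff _ _).mpr (hX i j))).mp
    (hlt i j)

omit [ValuativeRel F] in
/-- The pinned matrix with the extra pins `T` (exponent `N`) is `D + ϖ^N diag(𝟙_T)`. [folklore] -/
theorem gjPin_union_eq (S T : Finset (Fin n)) (hTS : ∀ i ∈ T, i ∉ S) (a : Fin n → ℕ) (N : ℕ) :
    gjPin ϖ (S ∪ T) (fun i => if i ∈ S then a i else N) =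
      gjPin ϖ S a + ϖ ^ N • Matrix.diagonal (fun i => if i ∈ T then (1 : F) else 0) := by
  ext i j
  rw [Matrix.add_apply, gjPin_apply, gjPin_apply, Matrix.smul_apply, Matrix.diagonal_apply, smul_eq_mul]
  by_cases hij : i = j
  · subst hij
    simp only [if_true, Finset.mem_union]
    by_cases hi : i ∈ S
    · have hiT : i ∉ T := fun h => hTS i h hi
      simp [hi, hiT]
    · by_cases hiT : i ∈ T
      · simp [hi, hiT]
      · simp [hi, hiT]
  · simp [hij]

/-- **The dichotomy, second case: the unpinned block is not divisible by `ϖ` — more pins.** With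
`D = gjPin ϖ S a`, `a_i + c ≤ N` on `S` (`c ≥ 1`) and `Z'` integral whose block `Sᶜ × Sᶜ` is not
`≡ 0 (mod ϖ)`, the matrix `D + ϖ^N Z'` lies in the class modulo `ϖ^{N+1}` of a twist
`κ D' κ'` (`κ, κ' ∈ GL_n(𝒪)`) of the pinned matrix `D' = gjPin ϖ (S ∪ T) a'` with a non-empty set
`T ⊆ Sᶜ` of new pins of exponent `N`: by `exists_corrections_gjPin_add`,
`D + ϖ^N Z' ≡ L D R + ϖ^N W (mod ϖ^{N+1})`, by `exists_blockElim` `P W Q ≡ Δ diag(𝟙_T) (mod ϖ)`,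
and then `κ = L P⁻¹ Δ`, `κ' = Q⁻¹ R` work since `P, Q, Δ` fix `D` and `L, R ≡ 1 (mod ϖ)`.
[folklore] -/
theorem exists_mem_gjClass_succ_morePins (hϖ : IsUniformizingElement ϖ) (hc : 1 ≤ c)
    (hgap : ∀ i ∈ S, a i + c ≤ N) {Z' : Matrix (Fin n) (Fin n) F} (hZ' : IsIntegralMatrix Z')
    (hnot : ¬ ∀ i ∉ S, ∀ j ∉ S, valuation F (Z' i j) ≤ valuation F ϖ) (m : ℕ) :
    ∃ κ κ' : GL (Fin n) F, κ ∈ glInt n F ∧ κ' ∈ glInt n F ∧ ∃ T : Finset (Fin n), T.Nonempty ∧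
      (∀ i ∈ T, i ∉ S) ∧
      gjPin ϖ S a + ϖ ^ N • Z' ∈ gjClass ϖ m (N + 1)
        ((κ : Matrix (Fin n) (Fin n) F) * gjPin ϖ (S ∪ T) (fun i => if i ∈ S then a i else N) *
          (κ' : Matrix (Fin n) (Fin n) F)) := by
  classical
  have hϖle : valuation F ϖ ≤ 1 := hϖ.valuation_le_one
  obtain ⟨L, R, hL, hR, hcorr⟩ := exists_corrections_gjPin_add hϖ hc hgap hZ'
  set D := gjPin ϖ S a with hD
  set W₀ : Matrix (Fin n) (Fin n) F := Matrix.of fun i j => if i ∉ S ∧ j ∉ S then Z' i j else 0 with hW₀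
  have hW₀int : IsIntegralMatrix W₀ := fun i j => by
    rw [hW₀, Matrix.of_apply]; split_ifs
    · exact hZ' i j
    · exact Subring.zero_mem _
  have hW₀supp : IsBlockSuppOn S W₀ := fun i j hij => by
    rw [hW₀, Matrix.of_apply, if_neg]
    rintro ⟨hi, hj⟩
    rcases hij with h | h
    · exact hi h
    · exact hj h
  obtain ⟨P, Q, Δ, hP, hQ, hΔ, -, hPinvone, -, hQinvone, hΔone, T, hTS, helim, hTempty⟩ :=
    exists_blockElim S hW₀int hW₀supp
  -- `T` is non-empty since the block is not divisible by `ϖ`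
  have hTne : T.Nonempty := by
    by_contra h
    rw [Finset.not_nonempty_iff_eq_empty] at h
    apply hnot
    intro i hi j hj
    have h1 := hTempty h i j
    rw [hW₀, Matrix.of_apply, if_pos ⟨hi, hj⟩] at h1
    exact (valuation_lt_one_iff_le_uniformizer hϖ (hZ' i j)).mp h1
  set E : Matrix (Fin n) (Fin n) F := Matrix.diagonal fun i => if i ∈ T then (1 : F) else 0 with hE
  have hEint : ValBound 1 E := fun i j => by
    rw [hE, Matrix.diagonal_apply]; split_ifs <;> simp
  set κ : GL (Fin n) F := L * P⁻¹ * Δ with hκ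
  set κ' : GL (Fin n) F := Q⁻¹ * R with hκ'
  have hLint : L ∈ glInt n F := congruenceGL_le_glInt _ hL
  have hRint : R ∈ glInt n F := congruenceGL_le_glInt _ hR
  refine ⟨κ, κ', Subgroup.mul_mem _ (Subgroup.mul_mem _ hLint (Subgroup.inv_mem _ hP)) hΔ,
    Subgroup.mul_mem _ (Subgroup.inv_mem _ hQ) hRint, T, hTne, hTS, mem_gjClass_of_valBound_sub ?_⟩
  -- `κ D' κ' = L D R + ϖ^N L M R`, `M = P⁻¹ Δ E Q⁻¹`
  set M : Matrix (Fin n) (Fin n) F := ((P⁻¹ : GL (Fin n) F) : Matrix (Fin n) (Fin n) F) *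
    (Δ : Matrix (Fin n) (Fin n) F) * E * ((Q⁻¹ : GL (Fin n) F) : Matrix (Fin n) (Fin n) F) with hM
  have hPinv1 : ValBound 1 ((P⁻¹ : GL (Fin n) F) : Matrix (Fin n) (Fin n) F) :=
    valBound_one_of_mem_glInt (Subgroup.inv_mem _ hP)
  have hQinv1 : ValBound 1 ((Q⁻¹ : GL (Fin n) F) : Matrix (Fin n) (Fin n) F) :=
    valBound_one_of_mem_glInt (Subgroup.inv_mem _ hQ)
  have hΔ1 : ValBound 1 (Δ : Matrix (Fin n) (Fin n) F) := valBound_one_of_mem_glInt hΔ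
  have hMint : ValBound 1 M := by
    have h := ((hPinv1.mul hΔ1).mul hEint).mul hQinv1
    simpa only [mul_one] using h
  have hkey : (κ : Matrix (Fin n) (Fin n) F) * gjPin ϖ (S ∪ T) (fun i => if i ∈ S then a i else N) *
      (κ' : Matrix (Fin n) (Fin n) F) =
      (L : Matrix (Fin n) (Fin n) F) * D * (R : Matrix (Fin n) (Fin n) F) +
        ϖ ^ N • ((L : Matrix (Fin n) (Fin n) F) * M * (R : Matrix (Fin n) (Fin n) F)) := by
    have h1 : (κ : Matrix (Fin n) (Fin n) F) * gjPin ϖ (S ∪ T) (fun i => if i ∈ S then a i else N) *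
        (κ' : Matrix (Fin n) (Fin n) F) =
        (L : Matrix (Fin n) (Fin n) F) * (((P⁻¹ : GL (Fin n) F) : Matrix (Fin n) (Fin n) F) *
          (Δ : Matrix (Fin n) (Fin n) F) * gjPin ϖ (S ∪ T) (fun i => if i ∈ S then a i else N) *
          ((Q⁻¹ : GL (Fin n) F) : Matrix (Fin n) (Fin n) F)) * (R : Matrix (Fin n) (Fin n) F) := by
      simp only [hκ, hκ', Units.val_mul, Matrix.mul_assoc]
    have h2 : ((P⁻¹ : GL (Fin n) F) : Matrix (Fin n) (Fin n) F) * (Δ : Matrix (Fin n) (Fin n) F) *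
        gjPin ϖ (S ∪ T) (fun i => if i ∈ S then a i else N) *
        ((Q⁻¹ : GL (Fin n) F) : Matrix (Fin n) (Fin n) F) = D + ϖ ^ N • M := by
      rw [gjPin_union_eq S T hTS a N, Matrix.mul_add, Matrix.add_mul, Matrix.mul_smul, Matrix.smul_mul,
        hM, ← hE, Matrix.mul_assoc _ (Δ : Matrix (Fin n) (Fin n) F) (gjPin ϖ S a), hΔone.mul_gjPin,
        hPinvone.mul_gjPin, hQinvone.gjPin_mul]
    rw [h1, h2, Matrix.mul_add, Matrix.add_mul, Matrix.mul_smul, Matrix.smul_mul]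
  -- `W₀ - L M R` is divisible by `ϖ`
  have hWM : ValBound (valuation F ϖ) (W₀ - M) := by
    have hint : ValBound 1 ((P : Matrix (Fin n) (Fin n) F) * W₀ * (Q : Matrix (Fin n) (Fin n) F) -
        (Δ : Matrix (Fin n) (Fin n) F) * E) :=
      (ValBound.integral_mul_mul (fun i j => (Valuation.mem_integer_iff _ _).mp (hW₀int i j))
        (valBound_one_of_mem_glInt hP) (valBound_one_of_mem_glInt hQ)).sub
        (by simpa only [one_mul] using hΔ1.mul hEint)
    have h1 := (valBound_uniformizer_of_lt_one hϖ hint helim).integral_mul_mul hPinv1 hQinv1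
    have e : ((P⁻¹ : GL (Fin n) F) : Matrix (Fin n) (Fin n) F) *
        ((P : Matrix (Fin n) (Fin n) F) * W₀ * (Q : Matrix (Fin n) (Fin n) F) -
          (Δ : Matrix (Fin n) (Fin n) F) * E) *
        ((Q⁻¹ : GL (Fin n) F) : Matrix (Fin n) (Fin n) F) = W₀ - M := by
      rw [Matrix.mul_sub, Matrix.sub_mul, hM]
      congr 1
      · rw [← Matrix.mul_assoc, ← Matrix.mul_assoc, ← Units.val_mul, inv_mul_cancel, Units.val_one,
          Matrix.one_mul, Matrix.mul_assoc, ← Units.val_mul, mul_inv_cancel, Units.val_one, Matrix.mul_one]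
      · simp only [Matrix.mul_assoc]
    rwa [e] at h1
  have hMLMR : ValBound (valuation F ϖ) (M - (L : Matrix (Fin n) (Fin n) F) * M * (R : Matrix (Fin n) (Fin n) F)) := by
    have e : M - (L : Matrix (Fin n) (Fin n) F) * M * (R : Matrix (Fin n) (Fin n) F) =
        -((((L : Matrix (Fin n) (Fin n) F) - 1) * M * (R : Matrix (Fin n) (Fin n) F)) +
          M * ((R : Matrix (Fin n) (Fin n) F) - 1)) := by noncomm_ring
    rw [e]
    have hc1 : valuation F ϖ ^ c ≤ valuation F ϖ := by
      obtain ⟨c', rfl⟩ : ∃ c', c = c' + 1 := ⟨c - 1, by omega⟩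
      rw [pow_succ]
      exact mul_le_of_le_one_left' (pow_le_one' hϖle _)
    refine ValBound.neg (ValBound.add ?_ ?_)
    · have h := (hL.2.1.mul hMint).mul (valBound_one_coe_of_mem_congruenceGL hR)
      rw [mul_one, mul_one] at h
      exact h.mono hc1
    · have h := hMint.mul hR.2.1
      rw [one_mul] at h
      exact h.mono hc1
  have hfinal : ValBound (valuation F ϖ ^ (N + 1))
      (ϖ ^ N • (W₀ - (L : Matrix (Fin n) (Fin n) F) * M * (R : Matrix (Fin n) (Fin n) F))) := by
    have h := (hWM.add hMLMR).pow_smul (ϖ := ϖ) N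
    rw [sub_add_sub_cancel, ← pow_succ] at h
    exact h
  -- assemble
  have e : gjPin ϖ S a + ϖ ^ N • Z' -
      (κ : Matrix (Fin n) (Fin n) F) * gjPin ϖ (S ∪ T) (fun i => if i ∈ S then a i else N) *
        (κ' : Matrix (Fin n) (Fin n) F) =
      (gjPin ϖ S a + ϖ ^ N • Z' - (L : Matrix (Fin n) (Fin n) F) * gjPin ϖ S a *
        (R : Matrix (Fin n) (Fin n) F) - ϖ ^ N • W₀) +
        ϖ ^ N • (W₀ - (L : Matrix (Fin n) (Fin n) F) * M * (R : Matrix (Fin n) (Fin n) F)) := by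
    rw [hkey, ← hD, smul_sub]
    abel
  rw [e]
  exact hcorr.add hfinal

/-- **The dichotomy for a member of a pinned class.** Let `m ≥ 0`, `c ≥ 1`, `a_i + c ≤ N` on `S`
and `X ∈ gjClass ϖ m N (gjPin ϖ S a)`. Then either `X ∈ gjClass ϖ m (N+1) (L D R)` for some
`L, R ∈ K_c` (`D = gjPin ϖ S a`), or `X ∈ gjClass ϖ m (N+1) (κ D' κ')` for some `κ, κ' ∈ GL_n(𝒪)`
and `D' = gjPin ϖ (S ∪ T) a'` with a non-empty set `T ⊆ Sᶜ` of new pins of exponent `N`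
(`a' = a` on `S`). Write `X = k (D + ϖ^N Z') k'` with `k, k' ∈ K_m` and apply
`exists_mem_gjClass_succ_of_block_small` / `exists_mem_gjClass_succ_morePins`. [folklore] -/
theorem mem_gjClass_succ_dichotomy (hϖ : IsUniformizingElement ϖ) (hc : 1 ≤ c)
    (hgap : ∀ i ∈ S, a i + c ≤ N) {X : Matrix (Fin n) (Fin n) F}
    (hX : X ∈ gjClass ϖ m N (gjPin ϖ S a)) :
    (∃ L R : GL (Fin n) F, L ∈ congruenceGL n (valuation F ϖ ^ c) ∧
        R ∈ congruenceGL n (valuation F ϖ ^ c) ∧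
        X ∈ gjClass ϖ m (N + 1)
          ((L : Matrix (Fin n) (Fin n) F) * gjPin ϖ S a * (R : Matrix (Fin n) (Fin n) F))) ∨
      ∃ κ κ' : GL (Fin n) F, κ ∈ glInt n F ∧ κ' ∈ glInt n F ∧ ∃ T : Finset (Fin n), T.Nonempty ∧
        (∀ i ∈ T, i ∉ S) ∧
        X ∈ gjClass ϖ m (N + 1)
          ((κ : Matrix (Fin n) (Fin n) F) * gjPin ϖ (S ∪ T) (fun i => if i ∈ S then a i else N) *
            (κ' : Matrix (Fin n) (Fin n) F)) := by
  have hϖ0 := hϖ.ne_zero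
  have hpow : ϖ ^ N ≠ 0 := pow_ne_zero _ hϖ0
  obtain ⟨k, hk, k', hk', h⟩ := hX
  -- `X = k (D + ϖ^N Z') k'` with `Z'` integral
  set E := X - (k : Matrix (Fin n) (Fin n) F) * gjPin ϖ S a * (k' : Matrix (Fin n) (Fin n) F) with hE
  set Z' : Matrix (Fin n) (Fin n) F := (ϖ ^ N)⁻¹ • (((k⁻¹ : GL (Fin n) F) : Matrix (Fin n) (Fin n) F) * E *
    ((k'⁻¹ : GL (Fin n) F) : Matrix (Fin n) (Fin n) F)) with hZ'
  have hZ'int : IsIntegralMatrix Z' := by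
    have hb := h.integral_mul_mul (valBound_one_coe_of_mem_congruenceGL (Subgroup.inv_mem _ hk))
      (valBound_one_coe_of_mem_congruenceGL (Subgroup.inv_mem _ hk'))
    intro i j
    rw [hZ', Matrix.smul_apply, smul_eq_mul, Valuation.mem_integer_iff, map_mul, map_inv₀, map_pow]
    have hv : valuation F ϖ ^ N ≠ 0 := valuation_pow_ne_zero' hϖ0 N
    calc (valuation F ϖ ^ N)⁻¹ * valuation F ((((k⁻¹ : GL (Fin n) F) : Matrix (Fin n) (Fin n) F) * E *
          ((k'⁻¹ : GL (Fin n) F) : Matrix (Fin n) (Fin n) F)) i j)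
        ≤ (valuation F ϖ ^ N)⁻¹ * valuation F ϖ ^ N := mul_le_mul_right (hb i j) _
      _ = 1 := inv_mul_cancel₀ hv
  have hXeq : X = (k : Matrix (Fin n) (Fin n) F) * (gjPin ϖ S a + ϖ ^ N • Z') *
      (k' : Matrix (Fin n) (Fin n) F) := by
    rw [hZ', smul_smul, mul_inv_cancel₀ hpow, one_smul, Matrix.mul_add, Matrix.add_mul]
    have e : (k : Matrix (Fin n) (Fin n) F) * (((k⁻¹ : GL (Fin n) F) : Matrix (Fin n) (Fin n) F) * E *
        ((k'⁻¹ : GL (Fin n) F) : Matrix (Fin n) (Fin n) F)) * (k' : Matrix (Fin n) (Fin n) F) = E := by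
      rw [← Matrix.mul_assoc, ← Matrix.mul_assoc, ← Units.val_mul, mul_inv_cancel, Units.val_one,
        Matrix.one_mul, Matrix.mul_assoc, ← Units.val_mul, inv_mul_cancel, Units.val_one, Matrix.mul_one]
    rw [e, hE, add_sub_cancel]
  by_cases hsmall : ∀ i ∉ S, ∀ j ∉ S, valuation F (Z' i j) ≤ valuation F ϖ
  · left
    obtain ⟨L, R, hL, hR, hmem⟩ := exists_mem_gjClass_succ_of_block_small hϖ hc hgap hZ'int hsmall m
    refine ⟨L, R, hL, hR, ?_⟩
    rw [hXeq, mul_coe_mem_gjClass_iff hk', coe_mul_mem_gjClass_iff hk]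
    exact hmem
  · right
    obtain ⟨κ, κ', hκ, hκ', T, hTne, hTS, hmem⟩ := exists_mem_gjClass_succ_morePins hϖ hc hgap hZ'int hsmall m
    refine ⟨κ, κ', hκ, hκ', T, hTne, hTS, ?_⟩
    rw [hXeq, mul_coe_mem_gjClass_iff hk', coe_mul_mem_gjClass_iff hk]
    exact hmem

/-- **The dichotomy under the gap condition** `a_i + m ≤ N` (`m ≥ 1`): a member of
`gjClass ϖ m N (gjPin ϖ S a)` lies in the deeper class `gjClass ϖ m (N+1) (gjPin ϖ S a)` or in the
class modulo `ϖ^{N+1}` of a twisted pinned matrix with strictly more pins. [folklore] -/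
theorem mem_gjClass_succ_or_morePins (hϖ : IsUniformizingElement ϖ) (hm : 1 ≤ m)
    (hgap : ∀ i ∈ S, a i + m ≤ N) {X : Matrix (Fin n) (Fin n) F}
    (hX : X ∈ gjClass ϖ m N (gjPin ϖ S a)) :
    X ∈ gjClass ϖ m (N + 1) (gjPin ϖ S a) ∨
      ∃ κ κ' : GL (Fin n) F, κ ∈ glInt n F ∧ κ' ∈ glInt n F ∧ ∃ T : Finset (Fin n), T.Nonempty ∧
        (∀ i ∈ T, i ∉ S) ∧
        X ∈ gjClass ϖ m (N + 1)
          ((κ : Matrix (Fin n) (Fin n) F) * gjPin ϖ (S ∪ T) (fun i => if i ∈ S then a i else N) *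
            (κ' : Matrix (Fin n) (Fin n) F)) := by
  rcases mem_gjClass_succ_dichotomy hϖ hm hgap hX with ⟨L, R, hL, hR, h⟩ | h
  · left
    rwa [gjClass_eq_of_mem (coe_mul_mul_coe_mem_gjClass m (N + 1) _ hL hR)] at h
  · exact Or.inr h

/-- **The dichotomy without gap condition** (`a_i < N` on `S`): a member of `gjClass ϖ m N (gjPin ϖ S a)`
lies in the class modulo `ϖ^{N+1}` of a twist `κ D' κ'`, `κ, κ' ∈ GL_n(𝒪)`, of a pinned matrix
`D' = gjPin ϖ (S ∪ T) a'` with `T ⊆ Sᶜ` possibly empty (`a' = a` on `S`, `a' = N` on `T`). [folklore] -/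
theorem exists_mem_gjClass_succ_twist (hϖ : IsUniformizingElement ϖ) (ha : ∀ i ∈ S, a i < N)
    {X : Matrix (Fin n) (Fin n) F} (hX : X ∈ gjClass ϖ m N (gjPin ϖ S a)) :
    ∃ κ κ' : GL (Fin n) F, κ ∈ glInt n F ∧ κ' ∈ glInt n F ∧ ∃ T : Finset (Fin n), (∀ i ∈ T, i ∉ S) ∧
      X ∈ gjClass ϖ m (N + 1)
        ((κ : Matrix (Fin n) (Fin n) F) * gjPin ϖ (S ∪ T) (fun i => if i ∈ S then a i else N) *
          (κ' : Matrix (Fin n) (Fin n) F)) := by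
  rcases mem_gjClass_succ_dichotomy hϖ le_rfl (fun i hi => ha i hi) hX with ⟨L, R, hL, hR, h⟩ | h
  · refine ⟨L, R, congruenceGL_le_glInt _ hL, congruenceGL_le_glInt _ hR, ∅, by simp, ?_⟩
    have e : gjPin ϖ (S ∪ ∅) (fun i => if i ∈ S then a i else N) = gjPin ϖ S a := by
      ext i j
      rw [Finset.union_empty, gjPin_apply, gjPin_apply]
      by_cases h1 : i = j
      · subst h1
        by_cases h2 : i ∈ S
        · simp [h2]
        · simp [h2]
      · simp [h1]
    rw [e]
    exact h
  · obtain ⟨κ, κ', hκ, hκ', T, -, hTS, hmem⟩ := h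
    exact ⟨κ, κ', hκ, hκ', T, hTS, hmem⟩

/-- **Smith normal form modulo `ϖ^N` under `GL_n(𝒪) × GL_n(𝒪)` and `K_m × K_m`.** Every integral
matrix `X` lies in `gjClass ϖ m N (κ (gjPin ϖ S a) κ')` for some `κ, κ' ∈ GL_n(𝒪)`, some set of pins
`S` and exponents `a_i < N` on `S` (induction on `N`, refining with
`exists_mem_gjClass_succ_twist`). [folklore] -/
theorem exists_mem_gjClass_twist_gjPin (hϖ : IsUniformizingElement ϖ) (m N : ℕ)
    {X : Matrix (Fin n) (Fin n) F} (hX : IsIntegralMatrix X) :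
    ∃ κ κ' : GL (Fin n) F, κ ∈ glInt n F ∧ κ' ∈ glInt n F ∧ ∃ (S : Finset (Fin n)) (a : Fin n → ℕ),
      (∀ i ∈ S, a i < N) ∧
      X ∈ gjClass ϖ m N ((κ : Matrix (Fin n) (Fin n) F) * gjPin ϖ S a * (κ' : Matrix (Fin n) (Fin n) F)) := by
  induction N with
  | zero =>
    refine ⟨1, 1, Subgroup.one_mem _, Subgroup.one_mem _, ∅, fun _ => 0, by simp, ?_⟩
    refine mem_gjClass_of_valBound_sub ?_
    rw [pow_zero]
    have e : gjPin ϖ (∅ : Finset (Fin n)) (fun _ => 0) = 0 := by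
      ext i j; rw [gjPin_apply]; simp
    rw [e, Matrix.mul_zero, Matrix.zero_mul, sub_zero]
    exact fun i j => (Valuation.mem_integer_iff _ _).mp (hX i j)
  | succ N ih =>
    obtain ⟨κ, κ', hκ, hκ', S, a, ha, hmem⟩ := ih
    -- untwist, refine, twist back
    have hmem' : ((κ⁻¹ : GL (Fin n) F) : Matrix (Fin n) (Fin n) F) * X *
        ((κ'⁻¹ : GL (Fin n) F) : Matrix (Fin n) (Fin n) F) ∈ gjClass ϖ m N (gjPin ϖ S a) := by
      rw [← mul_mul_mem_gjClass_iff hκ hκ']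
      have e : (κ : Matrix (Fin n) (Fin n) F) * (((κ⁻¹ : GL (Fin n) F) : Matrix (Fin n) (Fin n) F) * X *
          ((κ'⁻¹ : GL (Fin n) F) : Matrix (Fin n) (Fin n) F)) * (κ' : Matrix (Fin n) (Fin n) F) = X := by
        rw [← Matrix.mul_assoc, ← Matrix.mul_assoc, ← Units.val_mul, mul_inv_cancel, Units.val_one,
          Matrix.one_mul, Matrix.mul_assoc, ← Units.val_mul, inv_mul_cancel, Units.val_one, Matrix.mul_one]
      rw [e]
      exact hmem
    obtain ⟨κ₂, κ₂', hκ₂, hκ₂', T, hTS, h2⟩ := exists_mem_gjClass_succ_twist hϖ ha hmem'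
    refine ⟨κ * κ₂, κ₂' * κ', Subgroup.mul_mem _ hκ hκ₂, Subgroup.mul_mem _ hκ₂' hκ', S ∪ T,
      fun i => if i ∈ S then a i else N, fun i hi => ?_, ?_⟩
    · show (if i ∈ S then a i else N) < N + 1
      rcases Finset.mem_union.mp hi with h | h
      · rw [if_pos h]; exact (ha i h).trans (Nat.lt_succ_self N)
      · rw [if_neg (hTS i h)]; exact Nat.lt_succ_self N
    · rw [← mul_mul_mem_gjClass_iff hκ hκ'] at h2
      have e1 : (κ : Matrix (Fin n) (Fin n) F) * (((κ⁻¹ : GL (Fin n) F) : Matrix (Fin n) (Fin n) F) * X *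
          ((κ'⁻¹ : GL (Fin n) F) : Matrix (Fin n) (Fin n) F)) * (κ' : Matrix (Fin n) (Fin n) F) = X := by
        rw [← Matrix.mul_assoc, ← Matrix.mul_assoc, ← Units.val_mul, mul_inv_cancel, Units.val_one,
          Matrix.one_mul, Matrix.mul_assoc, ← Units.val_mul, inv_mul_cancel, Units.val_one, Matrix.mul_one]
      have e2 : (κ : Matrix (Fin n) (Fin n) F) * ((κ₂ : Matrix (Fin n) (Fin n) F) *
          gjPin ϖ (S ∪ T) (fun i => if i ∈ S then a i else N) * (κ₂' : Matrix (Fin n) (Fin n) F)) *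
          (κ' : Matrix (Fin n) (Fin n) F) =
          ((κ * κ₂ : GL (Fin n) F) : Matrix (Fin n) (Fin n) F) *
            gjPin ϖ (S ∪ T) (fun i => if i ∈ S then a i else N) *
            ((κ₂' * κ' : GL (Fin n) F) : Matrix (Fin n) (Fin n) F) := by
        simp only [Units.val_mul, Matrix.mul_assoc]
      rw [e1, e2] at h2
      exact h2

end Dichotomy

end Literature.NumberTheory.Automorphic
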